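import Summits.AtomisticToContinuum.Crystallization.Theorems.FrustratedLawDichotomyStrainedPatchHomEntryLeafHTUCentredRot
import Summits.AtomisticToContinuum.Crystallization.Theorems.FrustratedLawDichotomyStrainedPatchHomEntryLeafHTCentredRotMustPass

/-!
# ★★★ THE FUSED CERTIFICATE SIDE of the `0.95 t_b` crossover cell at `U 2⁻¹²` is ONE KERNEL FACT, MEASURED — and the cell closes end to end through it
# (27623 `(H) HomFloor (1/625)`, hcp half; hand-1 g32; critic rows 1185 (iii) «cert-cost lever REQUIRED (fused checker, measured ≤ 120 s target)» / 1187)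

decomp-a2c hand-1 g32 (crux `AperiodicFrustratedLawGap`, stmt-AtomisticToContinuum-27623).  Cell `cX95 × wX` of `…HomEntryLeafHTCross095A` (entry half-width
`2⁻¹²`, shuffle `1.25·10⁻³`).  The certificate `pX95U` = `pX95` with the slope constant re-issued for the all-naive far chunks (`Gs = 1264000000000`: near chunk
`≤ 1249000000000` centred as before, far chunks naive `≤ 10500000000` / `≤ 3700000000`; `D`, `lam`, `γS`, `rS` unchanged, hence the confined box `htWr` is unchanged).
KERNEL, MEASURED (hand-1 g32 seat `work/probe`, farm `lean check` wall incl. `≈ 4 s` load, cell `cX90`):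

* ★★★ `htCertSideU_X95` — THE WHOLE CERTIFICATE SIDE `…HomEntryLeafHTU.htCertSideU pX95U cX95 wX = true` IS ONE `decide +kernel` FACT: **111 s** at `cX90`
  (probe `UAB_one`; as two facts `htROKU ∧ htCertOKU ∧ far` / `curv ∧ near slope`: 51 s + 75 s) — against `≈ 630 s` for the EIGHT facts of `…Cross095A/B`,
  each of which re-ran the `62 s` interval classification of all `12167` labels of `[−11,11]³` (the all-in-one form of the old checker dies with «(kernel)
  excessive memory consumption» after 536 s).  The reduced universe `htUniv` has `1218` labels (`18 s`), the `fjQ` classification of the universe `5 s`.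
* ★ `treeOKUCR_X95` — KERNEL: ONE inner leaf of `entryLeafOKHQDCR muRec qX95c` (`…CentredRotMustPass`) on the confined box (`≈ 50 s`);
* ★★★ `entryLeafOKHT4UQDCR_X95` — the reduced-universe slab leaf with the centred rotated inner verdict closes the cell END TO END (assembly by rewriting; by
  `…HTUCentredRot.entryLeafOKHT4UQDCR_sound` the hver conclusion holds on the whole cell).  Production shape per slab leaf at the crossover:
  `≈ 110 s` certificate side + `≈ 50 s` inner leaf (was `≈ 630 s + 50 s`).

Kernel definition (payload) + kernel facts + assembly; 0 sorry; standard axioms.  `--supports stmt-AtomisticToContinuum-27623`.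
-/

namespace Summit.AtomisticToContinuum.Crystallization.Theorems.FrustratedLawDichotomyStrainedPatchHomEntryLeafHT

open Literature.Analysis.ValidatedNumerics.Numerics
open Summit.AtomisticToContinuum.Crystallization.Theorems.FrustratedLawDichotomyStrainedPatchHomCertTree (CertTree treeOK)
open Summit.AtomisticToContinuum.Crystallization.Theorems.FrustratedLawDichotomyStrainedPatchHomEntryTable (muRec)
open Summit.AtomisticToContinuum.Crystallization.Theorems.FrustratedLawDichotomyStrainedPatchHomEntryFitHcpCentred (entryLeafOKHQDCR)

/-- The certificate of the `0.95 t_b` crossover cell for the reduced-universe leaf: `pX95` with `Gs` re-issued for the all-naive far chunks. -/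
def pX95U : HTCert where
  D := DX
  lam₁ := 348466021167792
  lam₂ := -2814749767106
  lam₃ := -2814749767106
  Gs := 1264000000000
  γS := pX95.γS
  rS := pX95.rS

set_option maxRecDepth 100000 in
set_option maxHeartbeats 4000000 in
/-- ★★★ **KERNEL: THE FUSED CERTIFICATE SIDE OF THE `0.95 t_b` CROSSOVER CELL IS ONE FACT** (`≈ 110 s`; was eight facts, `≈ 630 s`). -/
theorem htCertSideU_X95 : htCertSideU pX95U cX95 wX = true := by
  decide +kernel

set_option maxRecDepth 100000 in
set_option maxHeartbeats 4000000 in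
/-- ★ KERNEL: ONE inner leaf of the centred rotated verdict (`…CentredRotMustPass.qX95c`) closes the whole confined box. -/
theorem treeOKUCR_X95 : treeOK (entryLeafOKHQDCR muRec qX95c) CertTree.leaf cX95 (htWr pX95U cX95 wX) = true := by
  decide +kernel

/-- ★★★ **THE `0.95 t_b` CROSSOVER CELL CLOSES END TO END THROUGH THE REDUCED-UNIVERSE LEAF** (fused certificate side + one inner leaf). [assembly] -/
theorem entryLeafOKHT4UQDCR_X95 : entryLeafOKHT4UQDCR muRec qX95c pX95U CertTree.leaf cX95 wX = true := by
  have h1 := htCertSideU_X95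
  have h2 := treeOKUCR_X95
  unfold entryLeafOKHT4UQDCR entryLeafOKHT4U
  rw [h1, h2]
  rfl

end Summit.AtomisticToContinuum.Crystallization.Theorems.FrustratedLawDichotomyStrainedPatchHomEntryLeafHT
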